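import Summits.QuantumFields.YangMills.Theorems.UnitScaleTiltProp7TowerClosenessStairs
import HarnessLib

/-!
# Route `UnitScaleTilt`, crux K1 «MinimiserStabilityRegPr» (stmt-QuantumFields-19200), route-R E′ (A′) «HCOW-VIA-Σ», row P-A2 «JOINT-Σ», file F3″-B1 —
# THE ONE-STEP ACCUMULATED-FRAME INEQUALITY, POINTWISE: THE CENTRE FRAME CANCELS EXACTLY AT FIRST ORDER
# `v·eml_i(v⁻¹·b_i) − 1 = |I|⁻¹Σ_i (b_i − 1) + v·Q`, `‖Q‖ ≤ 6t²` ⟹ `‖v_{l+1}(y) − 1‖ ≤ |I|⁻¹Σ_i (‖R_i − 1‖ + ‖a_i − 1‖) + 6t²`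

Cell `ym3-torus`, width seat `ym3-torus-px22` (gen 3); ★p1 g17 WORD 10 (4) «F3″ → px22»; LOCATE `LOCATE-PA2-F3-LEVELMASSES-px22g3.md` (★).  THE POINT.  The accumulated frames of the
covariant double-bar tower obey `v_{l+1}(y) = v_l(emb y)·w_l(y)` ((97), ✓ `frameAccU_succ`), `w_l(y) = eml_i tstair_i(y)` (✓ `coe_vframeCovU`), and — reading the twisted transports through
the PLAIN tower (✓ `frame_holT_dbarCovIterU_frame_inv_eq`) — `tstair_i(y) = v_l(emb y)⁻¹ · b_i` with `b_i = R_i · a_i`, `R_i` the SINGLE-BAR ratio transporter of the stair and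
`a_i = Ad_{Ū₀(st_i)}(v_l(x_i))` the frame at the stair's end.  §1 (abstract normed algebra): for any unit `v` and family `b_i`, `v·eml_i(v⁻¹b_i) − 1 = mean_i(b_i − 1) + v·Q` EXACTLY,
`Q` the second-order remainder of `exp[mean log]` (✓ `BlockAveragingEMLProp2.norm_eml_sub_one_sub_mean_le`: `‖Q‖ ≤ 6t²`), so the centre frame `v` drops out of the first order and
`‖v·eml_i(v⁻¹b_i) − 1‖ ≤ mean_i ‖b_i − 1‖ + 6t²` (`‖v‖ ≤ 1`); with `b_i = R_i·a_i`, `‖a_i‖ ≤ 1`: `≤ mean_i(‖R_i − 1‖ + ‖a_i − 1‖) + 6t²`.  §2: the same read on ✓ `frameAccU (k+1)`.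
This is the inequality (★) of the LOCATE whose `ℓ²` sum gives `Φ_{l+1} ≤ q·Φ_l + C·M^{sb}_l` (F3″-B2) for ✓ `Prop7TwistedLevelMassInduction.frameMass_induction` (F3″-A).
THEOREMS ONLY (0 `def`, 0 `sorry`); `--supports stmt-QuantumFields-19200`, count-neutral.  YM₃ on T³ is a ladder rung (R3), not the Clay problem; nothing here claims the stub, the crux, d = 4 or the gap.

References: T. Bałaban, CMP 98 (1985) 17–51 [Balaban1985Averaging] ((26)–(27) p.22, (58) p.27, (82) p.30, (89) p.31, (97) p.32); CMP 109 (1987) 249–301 [Balaban1987RG1] ((0.4) p.253).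
-/

set_option autoImplicit false

noncomputable section

open scoped BigOperators

namespace Summit.QuantumFields.YangMills.Theorems.Prop7AccumulatedFrameStep

open Literature.MathematicalPhysics.QuantumFieldTheory.Balaban1983to89
open ExpMeanLog (eml)
open BlockAveragingEMLProp2 (norm_eml_sub_one_sub_mean_le)

/-! ## §1 Abstract: the centre frame cancels at first order -/

section Abstract

variable {𝔸 : Type*} [NormedRing 𝔸] [NormedAlgebra ℂ 𝔸] [CompleteSpace 𝔸] {ι : Type*} [Fintype ι] [Nonempty ι]

omit [CompleteSpace 𝔸] [Nonempty ι] in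
/-- the norm of a mean is at most the mean of pointwise bounds. [folklore] -/
theorem norm_mean_le_mean {m : ι → 𝔸} {B : ι → ℝ} (h : ∀ i, ‖m i‖ ≤ B i) :
    ‖((Fintype.card ι : ℂ))⁻¹ • ∑ i, m i‖ ≤ (Fintype.card ι : ℝ)⁻¹ * ∑ i, B i := by
  rw [norm_smul, norm_inv, Complex.norm_natCast]
  exact mul_le_mul_of_nonneg_left ((norm_sum_le _ _).trans (Finset.sum_le_sum fun i _ => h i)) (by positivity)

omit [CompleteSpace 𝔸] in
/-- the mean of a constant family is the constant. [folklore] -/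
theorem mean_const (x : 𝔸) : ((Fintype.card ι : ℂ))⁻¹ • ∑ _i : ι, x = x := by
  rw [Finset.sum_const, Finset.card_univ, ← Nat.cast_smul_eq_nsmul ℂ, smul_smul, inv_mul_cancel₀ (Nat.cast_ne_zero.2 Fintype.card_ne_zero), one_smul]

omit [CompleteSpace 𝔸] in
/-- ★★ **THE CENTRE FRAME CANCELS AT FIRST ORDER (exact identity)**: for a unit `v` and any family `b_i`,
`v·eml_i(v⁻¹·b_i) − 1 = |I|⁻¹Σ_i (b_i − 1) + v·(eml_i(v⁻¹b_i) − 1 − |I|⁻¹Σ_i (v⁻¹b_i − 1))`. [cite: Balaban1985Averaging, (97) p.32, (26)-(27) p.22] -/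
theorem mul_eml_sub_one_eq (v : 𝔸ˣ) (b : ι → 𝔸) :
    (v : 𝔸) * eml (fun i => ((v⁻¹ : 𝔸ˣ) : 𝔸) * b i) - 1
      = ((Fintype.card ι : ℂ))⁻¹ • ∑ i, (b i - 1)
        + (v : 𝔸) * (eml (fun i => ((v⁻¹ : 𝔸ˣ) : 𝔸) * b i) - 1 - ((Fintype.card ι : ℂ))⁻¹ • ∑ i, (((v⁻¹ : 𝔸ˣ) : 𝔸) * b i - 1)) := by
  -- `v·mean(v⁻¹bᵢ − 1) = mean(bᵢ) − v`
  have hlin : (v : 𝔸) * (((Fintype.card ι : ℂ))⁻¹ • ∑ i, (((v⁻¹ : 𝔸ˣ) : 𝔸) * b i - 1)) = ((Fintype.card ι : ℂ))⁻¹ • ∑ i, b i - (v : 𝔸) := by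
    rw [mul_smul_comm, Finset.mul_sum]
    have e : ∀ i, (v : 𝔸) * (((v⁻¹ : 𝔸ˣ) : 𝔸) * b i - 1) = b i - (v : 𝔸) := fun i => by
      rw [mul_sub, ← mul_assoc, Units.mul_inv, one_mul, mul_one]
    simp only [e, Finset.sum_sub_distrib, smul_sub, mean_const]
  have hmean1 : ((Fintype.card ι : ℂ))⁻¹ • ∑ i, (b i - 1) = ((Fintype.card ι : ℂ))⁻¹ • ∑ i, b i - 1 := by
    rw [Finset.sum_sub_distrib, smul_sub, mean_const]
  rw [hmean1, mul_sub, mul_sub, mul_one, hlin]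
  abel

omit [NormedAlgebra ℂ 𝔸] [CompleteSpace 𝔸] in
/-- `‖v⁻¹·b − 1‖ ≤ ‖b − 1‖ + ‖v⁻¹ − 1‖` when `‖v⁻¹‖ ≤ 1` (so the sup letter `t` of the next theorem is fed by the sups of `b_i` and of the centre frame). [folklore] -/
theorem norm_inv_mul_sub_one_le (v : 𝔸ˣ) (hv : ‖((v⁻¹ : 𝔸ˣ) : 𝔸)‖ ≤ 1) (b : 𝔸) :
    ‖((v⁻¹ : 𝔸ˣ) : 𝔸) * b - 1‖ ≤ ‖b - 1‖ + ‖((v⁻¹ : 𝔸ˣ) : 𝔸) - 1‖ := by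
  have e : ((v⁻¹ : 𝔸ˣ) : 𝔸) * b - 1 = ((v⁻¹ : 𝔸ˣ) : 𝔸) * (b - 1) + (((v⁻¹ : 𝔸ˣ) : 𝔸) - 1) := by noncomm_ring
  rw [e]
  refine (norm_add_le _ _).trans (add_le_add ?_ le_rfl)
  exact (norm_mul_le _ _).trans (by nlinarith [norm_nonneg (b - 1), norm_nonneg (((v⁻¹ : 𝔸ˣ) : 𝔸))])

/-- ★★★ **THE ONE-STEP ACCUMULATED-FRAME INEQUALITY, ABSTRACT FORM**: `‖v‖ ≤ 1`, every `‖v⁻¹b_i − 1‖ ≤ t ≤ ¼` ⟹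
`‖v·eml_i(v⁻¹b_i) − 1‖ ≤ |I|⁻¹Σ_i ‖b_i − 1‖ + 6t²` — NO first-order dependence on the centre frame `v`. [cite: Balaban1985Averaging, (26)-(27) p.22, (97) p.32] -/
theorem norm_mul_eml_sub_one_le (v : 𝔸ˣ) (hv : ‖(v : 𝔸)‖ ≤ 1) (b : ι → 𝔸) {t : ℝ}
    (ht : ∀ i, ‖((v⁻¹ : 𝔸ˣ) : 𝔸) * b i - 1‖ ≤ t) (ht4 : t ≤ 1 / 4) :
    ‖(v : 𝔸) * eml (fun i => ((v⁻¹ : 𝔸ˣ) : 𝔸) * b i) - 1‖ ≤ (Fintype.card ι : ℝ)⁻¹ * ∑ i, ‖b i - 1‖ + 6 * t ^ 2 := by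
  rw [mul_eml_sub_one_eq]
  refine (norm_add_le _ _).trans (add_le_add (norm_mean_le_mean fun i => le_rfl) ?_)
  have hQ := norm_eml_sub_one_sub_mean_le (W := fun i => ((v⁻¹ : 𝔸ˣ) : 𝔸) * b i) ht ht4
  calc ‖(v : 𝔸) * (eml (fun i => ((v⁻¹ : 𝔸ˣ) : 𝔸) * b i) - 1 - ((Fintype.card ι : ℂ))⁻¹ • ∑ i, (((v⁻¹ : 𝔸ˣ) : 𝔸) * b i - 1))‖
      ≤ ‖(v : 𝔸)‖ * ‖eml (fun i => ((v⁻¹ : 𝔸ˣ) : 𝔸) * b i) - 1 - ((Fintype.card ι : ℂ))⁻¹ • ∑ i, (((v⁻¹ : 𝔸ˣ) : 𝔸) * b i - 1)‖ := norm_mul_le _ _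
    _ ≤ 1 * (6 * t ^ 2) := mul_le_mul hv hQ (norm_nonneg _) zero_le_one
    _ = 6 * t ^ 2 := one_mul _

/-- ★★★ **WITH THE STAIR SPLIT `b_i = R_i·a_i`** (`R_i` the single-bar ratio transporter, `a_i` the conjugated end frame, `‖a_i‖ ≤ 1`):
`‖v·eml_i(v⁻¹R_ia_i) − 1‖ ≤ |I|⁻¹Σ_i (‖R_i − 1‖ + ‖a_i − 1‖) + 6t²`. [cite: Balaban1985Averaging, (58) p.27, (82) p.30, (97) p.32] -/
theorem norm_mul_eml_sub_one_le_split (v : 𝔸ˣ) (hv : ‖(v : 𝔸)‖ ≤ 1) (R a : ι → 𝔸) (ha : ∀ i, ‖a i‖ ≤ 1) {t : ℝ}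
    (ht : ∀ i, ‖((v⁻¹ : 𝔸ˣ) : 𝔸) * (R i * a i) - 1‖ ≤ t) (ht4 : t ≤ 1 / 4) :
    ‖(v : 𝔸) * eml (fun i => ((v⁻¹ : 𝔸ˣ) : 𝔸) * (R i * a i)) - 1‖ ≤ (Fintype.card ι : ℝ)⁻¹ * ∑ i, (‖R i - 1‖ + ‖a i - 1‖) + 6 * t ^ 2 := by
  refine (norm_mul_eml_sub_one_le v hv (fun i => R i * a i) ht ht4).trans (add_le_add ?_ le_rfl)
  refine mul_le_mul_of_nonneg_left (Finset.sum_le_sum fun i _ => ?_) (by positivity)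
  -- `‖R·a − 1‖ ≤ ‖R − 1‖ + ‖a − 1‖` (`‖a‖ ≤ 1`; cf. ✓ `Prop7FlatCurrentLinearisation.norm_mul_sub_one_le`)
  have e : R i * a i - 1 = (R i - 1) * a i + (a i - 1) := by noncomm_ring
  rw [e]
  refine (norm_add_le _ _).trans (add_le_add ?_ le_rfl)
  exact (norm_mul_le _ _).trans (mul_le_of_le_one_right (norm_nonneg _) (ha i))

end Abstract

/-! ## §2 The reading on the accumulated frames of the covariant double-bar tower -/

section Frames

open T4Continuum BlockAveraging
open B10Eq27TorusAxialLog (holT transl)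
open B7Prop1Explicit (disp)
open Summit.QuantumFields.YangMills.Theorems.Prop8Chart (emlIterU)
open Summit.QuantumFields.YangMills.Theorems.Prop7SymAvgTwSym (tstairU tstairU_def vframeCovU coe_vframeCovU dbarCovIterU frameAccU frameAccU_succ)
open Summit.QuantumFields.YangMills.Theorems.Prop7TowerClosenessOfRegPr (frame_holT_dbarCovIterU_frame_inv_eq)

variable {P : Params} {𝔸 : Type*} [NormedRing 𝔸] [NormedAlgebra ℂ 𝔸] [CompleteSpace 𝔸]

/-- ★★ **THE TWISTED STAIR TRANSPORTER THROUGH THE PLAIN TOWER**: `tstair_i(y) = v_k(emb y)⁻¹ · (R_i · a_i)` with `R_i = Ū⁽ᵏ⁾(st_i)·Ū₀⁽ᵏ⁾(st_i)⁻¹` the SINGLE-BAR ratio transporter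
(plain tower `Ū⁽ᵏ⁾ = emlIterU k W` against `Ū₀⁽ᵏ⁾ = emlIterU k U₀`) and `a_i = Ū₀⁽ᵏ⁾(st_i)·v_k(x_i)·Ū₀⁽ᵏ⁾(st_i)⁻¹` the accumulated frame at the stair's end `x_i = emb y + disp st_i`, conjugated
(✓ `frame_holT_dbarCovIterU_frame_inv_eq`). [cite: Balaban1985Averaging, (58) p.27, (97) p.32] -/
theorem tstairU_eq_frame_inv_mul (k : ℕ) (U₀ W : GaugeField P 0 𝔸ˣ) (y : Site P (k + 1)) (i : Idx P) :
    tstairU (emlIterU k U₀) (dbarCovIterU k U₀ W) y i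
      = (frameAccU k U₀ W (emb y))⁻¹
        * ((holT (emlIterU k W) (emb y) (stairWord i.2.1 (off i.1)) * (holT (emlIterU k U₀) (emb y) (stairWord i.2.1 (off i.1)))⁻¹)
          * (holT (emlIterU k U₀) (emb y) (stairWord i.2.1 (off i.1)) * frameAccU k U₀ W (transl (emb y) (disp (stairWord i.2.1 (off i.1))))
            * (holT (emlIterU k U₀) (emb y) (stairWord i.2.1 (off i.1)))⁻¹)) := by
  rw [tstairU_def]
  have h := frame_holT_dbarCovIterU_frame_inv_eq k U₀ W (emb y) (stairWord i.2.1 (off i.1))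
  have h' : holT (dbarCovIterU k U₀ W) (emb y) (stairWord i.2.1 (off i.1))
      = (frameAccU k U₀ W (emb y))⁻¹ * holT (emlIterU k W) (emb y) (stairWord i.2.1 (off i.1)) * frameAccU k U₀ W (transl (emb y) (disp (stairWord i.2.1 (off i.1)))) := by
    rw [← h]; group
  rw [h']; group

/-- ★★★ **THE ONE-STEP ACCUMULATED-FRAME INEQUALITY ON THE TOWER** ((★) of the LOCATE): with `v_k = frameAccU k U₀ W`, `‖v_k(emb y)‖ ≤ 1`, the conjugated end frames of norm `≤ 1`,
and every twisted stair transporter within `t ≤ ¼` of `1`,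
`‖v_{k+1}(y) − 1‖ ≤ |Idx|⁻¹·Σ_i (‖R_i − 1‖ + ‖a_i − 1‖) + 6t²` — the centre frame `v_k(emb y)` does not enter at first order. [cite: Balaban1985Averaging, (82) p.30, (97) p.32, (26)-(27) p.22] -/
theorem norm_frameAccU_succ_sub_one_le (k : ℕ) (U₀ W : GaugeField P 0 𝔸ˣ) (y : Site P (k + 1)) {t : ℝ}
    (hv : ‖(frameAccU k U₀ W (emb y) : 𝔸)‖ ≤ 1)
    (ha : ∀ i : Idx P, ‖((holT (emlIterU k U₀) (emb y) (stairWord i.2.1 (off i.1)) * frameAccU k U₀ W (transl (emb y) (disp (stairWord i.2.1 (off i.1))))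
            * (holT (emlIterU k U₀) (emb y) (stairWord i.2.1 (off i.1)))⁻¹ : 𝔸ˣ) : 𝔸)‖ ≤ 1)
    (ht : ∀ i : Idx P, ‖((tstairU (emlIterU k U₀) (dbarCovIterU k U₀ W) y i : 𝔸ˣ) : 𝔸) - 1‖ ≤ t) (ht4 : t ≤ 1 / 4) :
    ‖(frameAccU (k + 1) U₀ W y : 𝔸) - 1‖
      ≤ (Fintype.card (Idx P) : ℝ)⁻¹ * ∑ i : Idx P,
          (‖((holT (emlIterU k W) (emb y) (stairWord i.2.1 (off i.1)) * (holT (emlIterU k U₀) (emb y) (stairWord i.2.1 (off i.1)))⁻¹ : 𝔸ˣ) : 𝔸) - 1‖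
            + ‖((holT (emlIterU k U₀) (emb y) (stairWord i.2.1 (off i.1)) * frameAccU k U₀ W (transl (emb y) (disp (stairWord i.2.1 (off i.1))))
                * (holT (emlIterU k U₀) (emb y) (stairWord i.2.1 (off i.1)))⁻¹ : 𝔸ˣ) : 𝔸) - 1‖)
        + 6 * t ^ 2 := by
  rw [frameAccU_succ, Units.val_mul, coe_vframeCovU]
  have e : (fun i : Idx P => ((tstairU (emlIterU k U₀) (dbarCovIterU k U₀ W) y i : 𝔸ˣ) : 𝔸))
      = fun i : Idx P => (((frameAccU k U₀ W (emb y))⁻¹ : 𝔸ˣ) : 𝔸)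
        * (((holT (emlIterU k W) (emb y) (stairWord i.2.1 (off i.1)) * (holT (emlIterU k U₀) (emb y) (stairWord i.2.1 (off i.1)))⁻¹ : 𝔸ˣ) : 𝔸)
          * ((holT (emlIterU k U₀) (emb y) (stairWord i.2.1 (off i.1)) * frameAccU k U₀ W (transl (emb y) (disp (stairWord i.2.1 (off i.1))))
            * (holT (emlIterU k U₀) (emb y) (stairWord i.2.1 (off i.1)))⁻¹ : 𝔸ˣ) : 𝔸)) := by
    funext i
    rw [tstairU_eq_frame_inv_mul, Units.val_mul, Units.val_mul]
  have ht' : ∀ i : Idx P, ‖(((frameAccU k U₀ W (emb y))⁻¹ : 𝔸ˣ) : 𝔸)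
        * (((holT (emlIterU k W) (emb y) (stairWord i.2.1 (off i.1)) * (holT (emlIterU k U₀) (emb y) (stairWord i.2.1 (off i.1)))⁻¹ : 𝔸ˣ) : 𝔸)
          * ((holT (emlIterU k U₀) (emb y) (stairWord i.2.1 (off i.1)) * frameAccU k U₀ W (transl (emb y) (disp (stairWord i.2.1 (off i.1))))
            * (holT (emlIterU k U₀) (emb y) (stairWord i.2.1 (off i.1)))⁻¹ : 𝔸ˣ) : 𝔸)) - 1‖ ≤ t := by
    intro i
    have h := ht i
    rwa [tstairU_eq_frame_inv_mul, Units.val_mul, Units.val_mul] at h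
  rw [e]
  exact norm_mul_eml_sub_one_le_split (frameAccU k U₀ W (emb y)) hv _ _ ha ht' ht4

end Frames

end Summit.QuantumFields.YangMills.Theorems.Prop7AccumulatedFrameStep

end
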